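import Literature.Probability.LatticeModels.DartPhase
import Literature.Probability.LatticeModels.DirichletGreenFunction
import Literature.Probability.RandomPlanarGeometry.PlanarDomains
import Summits.CriticalPhenomena.CardyFormulaZ2.Theorems.CardySusyWardParafermionPrecompactKenyonDefs
import Summits.CriticalPhenomena.CardyFormulaZ2.Theorems.CardySusyWardParafermionPrecompactFourDartSplit
import Summits.CriticalPhenomena.CardyFormulaZ2.Theorems.ParafermionPrecompact.Negative.ParafermionPrecompactFalseOfBulkNondegenerate
import Literature.Probability.LatticeModels.MedialInterfaceMeasurability

/-!
# Stub `stub_dartDictionary` of the line `kenyon-stream-second-relation` (crux `ParafermionPrecompact`)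

Route `CardySusyWard`, item stmt-CriticalPhenomena-11293, lead
`prover-line-stmt-CriticalPhenomena-11293-0`. The DART DICTIONARY between the crux's vertex
observable `F Λ δ z = ∫ passageSum (medialExploration (Λ δ) ω) δ (1/3) z dP_{1/2}` and the class
components `g_q(v) = Φ_E(v, v + c_q)` of the spin-`1/3` dart field `Φ_E = bondDartObservable E E.δ
(1/3)` (vocabulary of `…KenyonDefs`):

* (a) `dictionary_eventually`: for a discretisation family `Λ` of a Dobrushin domain `D`
  (`IsFamily D Λ`) and a compact `K ⊆ Ω`, eventually as `δ → 0⁺`, at every genuine medial vertex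
  `s(x, x + eᵢ)` with midpoint in `K`, `F Λ δ s(x, x+eᵢ) = κ Σ_q g_q(pivotOf x i q)`,
  `κ = (2cos(π/12))⁻¹`. The pathwise four-dart split (`fourDart_split_medialExploration`, file
  `…FourDartSplit`) is integrated term by term (`integrable_dartPhaseSum`: bounded by `1`,
  `norm_dartPhaseSum_le_one`, and a function of the exploration path, hence measurable,
  `measurable_of_medialExploration` — no admissibility needed); "eventually on `K`" only serves
  to exclude the two `A`–`B` edges, whose midpoints tend to the marked points `{a, b} ⊆ ∂Ω`
  (family field 5) while `K` has a closed `r`-thickening inside the open carrier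
  (`IsCompact.exists_cthickening_subset_open`, `MarkedDomain.pt_mem_frontier`).
* (b) `norm_classComp_le_touchProb`: for `E.δ > 0`, `‖g_q(w)‖ ≤ touchProb E (meshPoint E.δ w) E.δ`:
  the dart phase sum along the corner `(w, w + c_q)` has norm `≤ 1` and vanishes unless the
  exploration passes through the source edge of that corner, whose midpoint is within `δ` of `w`
  (`dist_medialPoint_cornerSource_le`); `E` need not be admissible.

`stub_dartDictionary` is the registered conjunction (a) ∧ (b), verbatim the skeleton's
`Sig.stub_dartDictionary`. References: S. Smirnov, Ann. of Math. 172 (2010), §2.2 [Smirnov2010];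
H. Duminil-Copin, S. Smirnov, Clay Math. Proc. 15 (2012), §8.3 [DuminilCopinSmirnov2012Lattice].
-/

noncomputable section

namespace Summit.CriticalPhenomena.CardyFormulaZ2.Cruxes.ParafermionPrecompact.KenyonStreamSecondRelation

open scoped BigOperators Topology
open Filter Set MeasureTheory
open _root_.Literature.Probability.LatticeModels
open _root_.Literature.Probability.RandomPlanarGeometry (DobrushinDomain)
open _root_.Literature.Probability.Percolation (BondConfig bondPercolation half)
open Summit.CriticalPhenomena.CardyFormulaZ2.Theorems.ParafermionPrecompact.Negative (F IsFamily)

/-! ### Expectation of the four-dart split -/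

/-- The dart phase sum of the exploration path is an integrable function of the configuration
(bounded by `1`, and a function of the exploration path, hence measurable), for EVERY datum `E`.
[folklore] -/
theorem integrable_dartPhaseSum (E : DiscreteDobrushin) (δ σ : ℝ) (c : Site 2 × Site 2) :
    Integrable (fun ω => Parafermion.dartPhaseSum (medialExploration E ω) δ σ c)
      (bondPercolation (zdGraph 2) half) :=
  Integrable.of_bound
    (measurable_of_medialExploration E
      (F := fun ω => Parafermion.dartPhaseSum (medialExploration E ω) δ σ c)
      (fun _ _ h => by simp only [h])).aestronglyMeasurable 1
    (ae_of_all _ fun ω => Parafermion.norm_dartPhaseSum_le_one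
      (Parafermion.nodup_zip_tail_medialExploration E ω) δ σ c)

/-- `κ · 2cos(π/12) = 1`. [folklore] -/
theorem kappa_mul_two_cos : (kappa : ℂ) * ((2 * Real.cos (Real.pi / 12) : ℝ) : ℂ) = 1 := by
  have h : 0 < 2 * Real.cos (Real.pi / 12) := by
    have : 0 < Real.cos (Real.pi / 12) := Real.cos_pos_of_mem_Ioo ⟨by linarith [Real.pi_pos],
      by linarith [Real.pi_pos]⟩
    linarith
  rw [kappa, Complex.ofReal_inv, inv_mul_cancel₀]
  exact_mod_cast h.ne'

/-- **The dictionary at one mesh.** If `(Λ δ).δ = δ > 0` and the genuine medial vertex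
`s(x, x + eᵢ)` is not an `A`–`B` edge of `Λ δ`, then `F Λ δ s(x, x+eᵢ) = κ Σ_q g_q(pivot_q)` for
the class components `g_q` of the dart field of `Λ δ`. [folklore] -/
theorem F_eq_kappa_mul_sum (Λ : ℝ → DiscreteDobrushin) {δ : ℝ} (hδ : 0 < δ) (hΛ : (Λ δ).δ = δ)
    (x : Site 2) (i : Fin 2) (hz : mv (x, i) ∉ (Λ δ).zdABEdges) :
    F Λ δ (mv (x, i)) = (kappa : ℂ) * ∑ q : Fin 4, classComp (dartField (Λ δ)) q (pivotOf x i q) := by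
  have key : ∀ ω, MedialPath.passageSum (medialExploration (Λ δ) ω) δ (1 / 3) (mv (x, i)) =
      (kappa : ℂ) * ∑ q : Fin 4, Parafermion.dartPhaseSum (medialExploration (Λ δ) ω) δ (1 / 3)
        (pivotOf x i q, pivotOf x i q + classOffset q) := fun ω => by
    rw [← fourDart_split_medialExploration (Λ δ) δ hδ.ne' ω x i hz, ← mul_assoc,
      kappa_mul_two_cos, one_mul]
  simp only [F, key, integral_const_mul]
  rw [integral_finsetSum _ fun q _ => integrable_dartPhaseSum (Λ δ) δ (1 / 3) _]
  simp only [classComp, dartField, Parafermion.bondDartObservable_def, hΛ]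

/-! ### Part (a): eventually in the mesh, on compact sets -/

/-- **Part (a).** For a discretisation family of a Dobrushin domain and a compact `K ⊆ Ω`,
eventually as `δ → 0⁺` the vertex observable at every genuine medial vertex with midpoint in `K`
is `κ` times the sum of the four class components of the dart field at their pivots (the two
`A`–`B` edges have midpoints tending to the marked points of `∂Ω`, at positive distance from
`K`). [folklore] -/
theorem dictionary_eventually (D : DobrushinDomain) (Λ : ℝ → DiscreteDobrushin)
    (hΛ : IsFamily D Λ) (K : Set ℂ) (hK : IsCompact K) (hKD : K ⊆ D.carrier) :
    ∀ᶠ δ in 𝓝[>] (0:ℝ), ∀ (x : Site 2) (i : Fin 2), medialPoint δ (mv (x, i)) ∈ K →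
      F Λ δ (mv (x, i)) =
        (kappa : ℂ) * ∑ q : Fin 4, classComp (dartField (Λ δ)) q (pivotOf x i q) := by
  obtain ⟨-, hδ, -, -, hAB, -⟩ := hΛ
  obtain ⟨r, hr, hrK⟩ := hK.exists_cthickening_subset_open D.isOpen hKD
  have hev : ∀ᶠ δ in 𝓝[>] (0:ℝ), Metric.hausdorffEDist (medialPoint δ '' (Λ δ).zdABEdges)
      {D.pt 0, D.pt 1} < ENNReal.ofReal r :=
    hAB.eventually (gt_mem_nhds (ENNReal.ofReal_pos.2 hr))
  filter_upwards [hev, self_mem_nhdsWithin] with δ hδlt hδpos x i hxK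
  refine F_eq_kappa_mul_sum Λ hδpos (hδ δ) x i fun hz => ?_
  obtain ⟨y, hy, hdist⟩ :=
    Metric.exists_edist_lt_of_hausdorffEDist_lt (mem_image_of_mem _ hz) hδlt
  have hyf : y ∈ frontier D.carrier := by
    rcases hy with rfl | rfl <;> exact D.pt_mem_frontier _
  have hyD : y ∈ D.carrier := hrK (Metric.mem_cthickening_of_dist_le _ _ _ _ hxK
    (by rw [dist_comm]; exact (edist_lt_ofReal.1 hdist).le))
  exact hyf.2 (interior_maximal Subset.rfl D.isOpen hyD)

/-! ### Part (b): class components are bounded by touch probabilities -/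

/-- **Part (b).** For `E.δ > 0`, `‖g_q(w)‖ ≤ P(the exploration visits the δ-ball at w)`: the dart
phase sum along the class-`q` corner at `w` has norm at most `1` and vanishes unless the
exploration passes through the source edge of that corner, whose midpoint is within `δ` of `w`.
[folklore] -/
theorem norm_classComp_le_touchProb (E : DiscreteDobrushin) (hE : 0 < E.δ) (q : Fin 4)
    (w : Site 2) : ‖classComp (dartField E) q w‖ ≤ touchProb E (meshPoint E.δ w) E.δ := by
  simp only [classComp, dartField, Parafermion.bondDartObservable_def, touchProb]
  set S : Set (BondConfig (Site 2)) :=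
    {ω | ∃ e ∈ medialExploration E ω, dist (medialPoint E.δ e) (meshPoint E.δ w) ≤ E.δ}
  set f : BondConfig (Site 2) → ℂ := fun ω =>
    Parafermion.dartPhaseSum (medialExploration E ω) E.δ (1 / 3) (w, w + classOffset q)
  have hSm : MeasurableSet S :=
    measurableSet_setOf.2 (measurable_of_medialExploration E
      (F := fun ω => ∃ e ∈ medialExploration E ω, dist (medialPoint E.δ e) (meshPoint E.δ w) ≤ E.δ)
      fun _ _ h => by simp only [h])
  have hfS : f = S.indicator f := by
    funext ω
    by_cases hω : ω ∈ S
    · rw [indicator_of_mem hω]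
    · rw [indicator_of_notMem hω]
      exact Parafermion.dartPhaseSum_eq_zero_of_not_mem _ _ fun hmem =>
        hω ⟨_, hmem,
          dist_medialPoint_cornerSource_le hE.le ((isCorner_iff_classOffset _ _).2 ⟨q, rfl⟩)⟩
  change ‖∫ ω, f ω ∂_‖ ≤ _
  rw [hfS, integral_indicator hSm]
  refine (norm_setIntegral_le_of_norm_le_const (measure_lt_top _ _) fun ω _ => ?_).trans
    (by rw [one_mul])
  exact Parafermion.norm_dartPhaseSum_le_one (Parafermion.nodup_zip_tail_medialExploration E ω) _ _ _

/-! ### The registered stub -/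

/-- **Registered stub `stub_dartDictionary`** of the line `kenyon-stream-second-relation`:
(a) eventually in `δ` on compacts, the vertex observable at a genuine medial vertex is `κ` times
the sum of the four class components of the dart field at their pivots; (b) each class component
is bounded by the touch probability of the `δ`-ball at its pivot. [folklore] -/
theorem stub_dartDictionary :
    (∀ (D : DobrushinDomain) (Λ : ℝ → DiscreteDobrushin), IsFamily D Λ →
        ∀ K : Set ℂ, IsCompact K → K ⊆ D.carrier →
          ∀ᶠ δ in 𝓝[>] (0:ℝ), ∀ (x : Site 2) (i : Fin 2), medialPoint δ (mv (x, i)) ∈ K →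
            F Λ δ (mv (x, i)) =
              (kappa : ℂ) * ∑ q : Fin 4, classComp (dartField (Λ δ)) q (pivotOf x i q)) ∧
      ∀ (E : DiscreteDobrushin), 0 < E.δ → ∀ (q : Fin 4) (w : Site 2),
        ‖classComp (dartField E) q w‖ ≤ touchProb E (meshPoint E.δ w) E.δ :=
  ⟨dictionary_eventually, norm_classComp_le_touchProb⟩

end Summit.CriticalPhenomena.CardyFormulaZ2.Cruxes.ParafermionPrecompact.KenyonStreamSecondRelation

end
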